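import Mathlib
import HarnessLib
import Summits.NavierStokesRegularity.NavierStokesRegularity.Theses.LocalRuledPressureDoor
import Summits.NavierStokesRegularity.NavierStokesRegularity.Theorems.LocalRuledPressureDoorLocalPointZoomSimilarityPressure
import Summits.NavierStokesRegularity.NavierStokesRegularity.Theorems.LocalRuledPressureDoorRuledPressureCollapse
import Summits.NavierStokesRegularity.NavierStokesRegularity.Theorems.LocalRuledPressureDoorPressurelessProfileRigidity

/-!
# THE RULED-PRESSURE DOOR IS CLOSED BY PROOF: `LocalRuledPressureDoor.Target` (item stmt-NavierStokesRegularity-27997)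

* `localRuledPressureDoor_target_proof : LocalRuledPressureDoor.Target` — the route's planner-authored, kernel-checked deciding
  theorem `Theses.LocalRuledPressureDoor.closes` applied to the three PROVED items:
  `localRuledPressureDoor_localPointZoomSimilarityPressure_proof` (K1, item 28000, typer g33 — verbatim twin of the proved
  pressure zoom 20181 of the pressure-profile door), `localRuledPressureDoor_ruledPressureCollapse_proof` (K3, THE LEVER, item
  27999, ns-imp-p1 g4: an `e`-ruled similarity pressure on one ball of every slice collapses to `Q[v] ≡ 0` by slice analyticity
  + apex decay) and `localRuledPressureDoor_pressurelessProfileRigidity_proof` (K2, item 27998, ns-tc-p1 g5: a pressureless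
  door-class profile is not backward-singular — the case `0 ≤ 0` of the proved monotone-pressure rigidity).

THE DOOR (instrument criterion, LADDER-NS rung N0 «N0-LocalTubeDoorRuledPressure», now a theorem): a classical Navier–Stokes
solution on `[0,T)`, Leray–Hopf from a rapidly decaying datum, locally SPACE–TIME Type I at `(x₀,T)`, whose similarity Riesz
pressure `P(t,y) = (T−t)·Q[u(t)](x₀+√(T−t)y)` becomes, as `t ↑ T`, invariant under the translations `y ↦ y + h e`
(`0 ≤ h ≤ h₀`) for ONE direction `e ≠ 0` on ONE similarity ball `B(y₀,r)`, is backward bounded at `x₀`.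

HONEST FRAMING: a DOOR about HYPOTHETICAL locally Type-I blow-ups closes by proof (unconditional, standard axioms).  A door is a
regularity CRITERION — «a Type-I singularity cannot have an asymptotically ruled similarity pressure on a window» — and proves
NO summit statement: it is vacuous iff local space–time Type-I blow-up is impossible (hard core stmt-0056/10661, untouched);
Navier–Stokes regularity (Clay A–D) is OPEN and untouched by this file.
-/

noncomputable section

set_option linter.dupNamespace false

namespace Summit.NavierStokesRegularity.NavierStokesRegularity.Theorems

/-- **Item stmt-NavierStokesRegularity-27997** (`LocalRuledPressureDoor.Target`): THE RULED-PRESSURE DOOR, by the route's deciding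
theorem `closes` on the three proved items K1 (28000), K3 (27999), K2 (27998).
[cite: SereginSverak2002, §1; KochNadirashviliSereginSverak2009, §5] -/
theorem localRuledPressureDoor_target_proof :
    Summit.NavierStokesRegularity.NavierStokesRegularity.Theses.LocalRuledPressureDoor.Target :=
  Summit.NavierStokesRegularity.NavierStokesRegularity.Theses.LocalRuledPressureDoor.closes
    localRuledPressureDoor_localPointZoomSimilarityPressure_proof
    localRuledPressureDoor_ruledPressureCollapse_proof
    localRuledPressureDoor_pressurelessProfileRigidity_proof

end Summit.NavierStokesRegularity.NavierStokesRegularity.Theorems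

end
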